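import Summits.ResolutionOfSingularities.ResolutionOfSingularities.Theorems.WildQuotientsSummitReductionStubPairOrbitBlowupCentreFlatLemmas
import Summits.ResolutionOfSingularities.ResolutionOfSingularities.Theorems.WildQuotientsSummitReductionStubPairOrbitBlowupCentreFlatLemmas3
import Literature.AlgebraicGeometry.Resolution.StalkIdealLemmas
import HarnessLib

/-!
# `WildQuotients.SummitReduction` (stmt-ResolutionOfSingularities-16324), line `FramePerfect`:
# lemmas for stub C1 (`stub_pair_orbitBlowupCentreFlat`) — the completed ideal of the orbit
# closure `cl(G · x)` at any of its points is `(u, v, t)` with `uv = c · t²`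

Route `ResolutionOfSingularities/WildQuotients`, crux `SummitReduction`; helper file of the line
skeleton (v8), stub C1 = de Jong 1996, 3.4 Claim (ii) over the centre of the blow-up of the orbit
closure `Z = cl(G · x)` of a codimension-2 singular point `x` of a quasi-split `G`-semi-stable
pair (de Jong 1997, proof of Prop. 5.11 ¶1). The any-field, orbit analogue of the tree's
`DeJong1996.SemiStablePair.exists_nodeDeformationRing_centre_compat`
(`AlterationsSemiStableCodimTwoBlowupFlat.lean`: one component `cl{x}`, Situation 4.23 over an
algebraically closed field, at a closed point):

* `centreFlat_stalkIdeal_vanishingIdeal_closure_orbit` — `Z = ⋃_g cl{x_g}`, `x_g = ρ(g) x`, so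
  `I(Z)_z = ⋂_g I(cl{x_g})_z`;
* `centreFlat_exists_nodeDeformationRing_orbitCentre_compat` — **at EVERY point `z ∈ Z`**: formal
  coordinates `e : 𝒪̂_{X,z} ≅ Λ⟦u, v⟧/(uv - c t²)`, `Λ = κ(f z)⟦T₁, …, T_m⟧`, `t ≠ 0`, over the flat
  `β : 𝒪_{Y,f z} → 𝒪̂_{Y,f z} ≅ Λ`, carrying `I(Z)_z 𝒪̂_{X,z}` onto the centre `(u, v, t)` of the
  charts of p. 64 (`nodalCentre`). Proof: formal coordinates `Λ⟦u, v⟧/(uv - ∏ Tᵢ^{νᵢ})` at `z`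
  (2.23 + 3.3, `centreFlat_exists_formalCoordinates`); each translate `cl{x_g} ∋ z` has completed
  ideal `(u, v, T_{i(g)})` with `ν_{i(g)} ≥ 2` (3.4 ¶2, `codimTwo_map_adicCompletion_eq_triplePrime`,
  `𝒪_{X,z}` being a G-ring); extension to the flat `𝒪̂_{X,z}` commutes with the finite
  intersection, and `⋂_{i ∈ S} (u, v, Tᵢ) = (u, v, t)`, `t = ∏_{i ∈ S} Tᵢ`, `∏ Tᵢ^{νᵢ} = c t²`
  (`centreFlat_iInf_span_triple_X`, `centreFlat_prod_pow_eq_mul_sq`). No `G`-strictness of `D` is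
  needed for this: several translates may well pass through `z`.
-/

-- the problem path `ResolutionOfSingularities/ResolutionOfSingularities` makes the conventional
-- namespace repeat a component, which `linter.dupNamespace` flags
set_option linter.dupNamespace false

noncomputable section

open CategoryTheory CategoryTheory.Limits AlgebraicGeometry TopologicalSpace
open Literature.AlgebraicGeometry.Resolution
open Literature.AlgebraicGeometry.Resolution.DeJong1996
open Literature.AlgebraicGeometry.Resolution.DeJong1996.NodeDeformationRing
open Literature.AlgebraicGeometry.Resolution.DeJong1996.FormalNodeRing
open Literature.AlgebraicGeometry
open Scheme.IdealSheafData IsLocalRing NodalDeformation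

namespace Summit.ResolutionOfSingularities.ResolutionOfSingularities.Theorems

/-! ## The stalk of the ideal of the orbit closure -/

/-- **`I(cl(G · x))_z = ⋂_g I(cl{ρ(g) x})_z`**: the orbit closure of a point under a finite group
is the finite union of the closures of its translates, and stalks of vanishing ideals turn finite
unions into intersections. [folklore] -/
theorem centreFlat_stalkIdeal_vanishingIdeal_closure_orbit {X : Scheme.{0}} {G : Type} [Group G]
    [Fintype G] (ρX : G →* Aut X) (x z : X) :
    stalkIdeal (vanishingIdeal ⟨closure (Set.range fun g : G => (ρX g).hom.base x),
        isClosed_closure⟩) z =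
      ⨅ g : G, stalkIdeal (vanishingIdeal ⟨closure {(ρX g).hom.base x}, isClosed_closure⟩) z := by
  have hZ : (⟨closure (Set.range fun g : G => (ρX g).hom.base x), isClosed_closure⟩ : Closeds X) =
      Finset.univ.sup fun g : G => (⟨closure {(ρX g).hom.base x}, isClosed_closure⟩ : Closeds X) := by
    apply Closeds.ext
    rw [Closeds.coe_finset_sup, Finset.sup_set_eq_biUnion, Closeds.coe_mk,
      ← Set.iUnion_singleton_eq_range, closure_iUnion_of_finite]
    simp
  rw [hZ, Finset.sup_univ_eq_iSup, vanishingIdeal_iSup, ← Finset.inf_univ_eq_iInf,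
    stalkIdeal_finset_inf, Finset.inf_univ_eq_iInf]

/-- Off `cl{η}` the stalk of its vanishing ideal is the unit ideal. [folklore] -/
theorem centreFlat_stalkIdeal_vanishingIdeal_closure_eq_top {X : Scheme.{0}} {η z : X}
    (h : ¬ η ⤳ z) : stalkIdeal (vanishingIdeal ⟨closure {η}, isClosed_closure⟩) z = ⊤ := by
  apply stalkIdeal_eq_top_of_not_mem_support
  rw [← SetLike.mem_coe, coe_support_vanishingIdeal]
  change z ∉ closure {η}
  rwa [← specializes_iff_mem_closure]

/-- Extension along a ring isomorphism commutes with intersections. [folklore] -/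
theorem centreFlat_map_iInf_ringEquiv {R S : Type*} [Semiring R] [Semiring S] (e : R ≃+* S)
    {ι : Sort*} (J : ι → Ideal R) :
    (⨅ i, J i).map e.toRingHom = ⨅ i, (J i).map e.toRingHom := by
  rw [RingEquiv.toRingHom_eq_coe, Ideal.map_comap_of_equiv, Ideal.comap_iInf]
  exact iInf_congr fun i => (Ideal.map_comap_of_equiv _).symm

/-! ## The formal model at a point of the orbit closure -/

-- the stalk instances make a few definitional unifications slow (kabstract on `𝒪̂_{X,z}`-ideals)
set_option maxHeartbeats 800000 in
/-- **de Jong 1996, 3.3 + 3.4 ¶2 at a point of the orbit closure, in the form used by the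
transfers of flatness and connectedness (any field, quasi-split, orbit version of the tree's
`exists_nodeDeformationRing_centre_compat`).** For `Y → Spec k` regular locally Noetherian,
`D ⊆ Y` a strict normal crossings divisor, `X` locally Noetherian and locally of finite type over
`k`, `f : X ⟶ Y` a quasi-split semi-stable curve smooth over `Y ∖ D`, a finite group `G` acting on
`X`, a codimension-`≤ 2` singular point `x`, and ANY point `z` of `Z = cl(G · x)`: Cohen
coordinates `Λ = κ(f z)⟦T₁, …, T_m⟧` with the flat `β : 𝒪_{Y,f z} → 𝒪̂_{Y,f z} ≅ Λ`, elements
`c, t ∈ Λ`, `t ≠ 0`, and `e : 𝒪̂_{X,z} ≅ Λ⟦u, v⟧/(uv - c t²)` compatible with `β` and carrying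
`I(Z)_z 𝒪̂_{X,z}` onto the centre `(u, v, t)` (`nodalCentre`) of the three charts of p. 64. Here
`t = ∏_{i ∈ S} Tᵢ` over the set `S` of branches `(u, v, Tᵢ)` (3.4 ¶2: "the complete local ring of
`T` at `x` corresponds to the quotient map `B → A'/t₁A'`. The integer `n₁` must be `≥ 2`") of the
translates `cl{ρ(g) x}` through `z`. [cite: DeJong1996, 3.3–3.4, pp. 63–64]
[cite: DeJong1997, proof of Prop. 5.11, p. 618] -/
theorem centreFlat_exists_nodeDeformationRing_orbitCentre_compat {k : Type} [Field k]
    {X Y : Scheme.{0}} [IsLocallyNoetherian X] [IsLocallyNoetherian Y] (q : Y ⟶ Spec (.of k))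
    (hreg : Scheme.IsRegular Y) {D : Set Y} (hD : IsStrictNormalCrossingsDivisor Y D)
    (f : X ⟶ Y) [LocallyOfFiniteType (f ≫ q)] (hss : IsSemiStableCurve f)
    (hqs : (∀ x : X, (¬ ∃ U : X.Opens, x ∈ U ∧ Smooth (U.ι ≫ f)) →
        ∃ e : AdicCompletion
            ((IsLocalRing.maximalIdeal (X.presheaf.stalk x)).map (Ideal.Quotient.mk
              ((IsLocalRing.maximalIdeal (Y.presheaf.stalk (f.base x))).map (f.stalkMap x).hom)))
            (X.presheaf.stalk x ⧸
              (IsLocalRing.maximalIdeal (Y.presheaf.stalk (f.base x))).map (f.stalkMap x).hom) ≃+*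
          MvPowerSeries (Fin 2) (Y.presheaf.stalk (f.base x) ⧸ IsLocalRing.maximalIdeal (Y.presheaf.stalk (f.base x))) ⧸
            Ideal.span {(MvPowerSeries.X 0 * MvPowerSeries.X 1 :
              MvPowerSeries (Fin 2) (Y.presheaf.stalk (f.base x) ⧸ IsLocalRing.maximalIdeal (Y.presheaf.stalk (f.base x))))},
          e.toRingHom.comp ((algebraMap (X.presheaf.stalk x ⧸
              (IsLocalRing.maximalIdeal (Y.presheaf.stalk (f.base x))).map (f.stalkMap x).hom) _).comp
            (Ideal.quotientMap ((IsLocalRing.maximalIdeal (Y.presheaf.stalk (f.base x))).map (f.stalkMap x).hom)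
              (f.stalkMap x).hom Ideal.le_comap_map)) =
          algebraMap (Y.presheaf.stalk (f.base x) ⧸ IsLocalRing.maximalIdeal (Y.presheaf.stalk (f.base x))) _))
    (hsm : Smooth (f ∣_ ⟨Dᶜ, hD.isClosed.isOpen_compl⟩))
    {G : Type} [Group G] [Finite G] (ρX : G →* Aut X) {x : X}
    (hx : x ∈ Scheme.singularLocusCodimLE X 2) {z : X}
    (hz : z ∈ closure (Set.range fun g : G => (ρX g).hom.base x)) :
    ∃ (m : ℕ) (c t : MvPowerSeries (Fin m) (ResidueField (Y.presheaf.stalk (f.base z))))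
      (_ : t ≠ 0)
      (e : Cpl (X.presheaf.stalk z) ≃+*
        NodeDeformationRing (MvPowerSeries (Fin m) (ResidueField (Y.presheaf.stalk (f.base z))))
          (c * t ^ 2))
      (β : Y.presheaf.stalk (f.base z) →+*
        MvPowerSeries (Fin m) (ResidueField (Y.presheaf.stalk (f.base z)))), β.Flat ∧
      (∀ a, e (algebraMap _ _ ((f.stalkMap z).hom a)) =
        algebraMap (MvPowerSeries (Fin m) (ResidueField (Y.presheaf.stalk (f.base z)))) _ (β a)) ∧
      ((stalkIdeal (vanishingIdeal ⟨closure (Set.range fun g : G => (ρX g).hom.base x),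
          isClosed_closure⟩) z).map (algebraMap (X.presheaf.stalk z) (Cpl (X.presheaf.stalk z)))).map
        e.toRingHom =
      (nodalCentre (MvPowerSeries (Fin m) (ResidueField (Y.presheaf.stalk (f.base z)))) c t).map
        (AlgebraicNodeRing.toNodeDeformationRing
          (MvPowerSeries (Fin m) (ResidueField (Y.presheaf.stalk (f.base z)))) (c * t ^ 2)).toRingHom := by
  classical
  haveI := Fintype.ofFinite G
  haveI := hss.locallyOfFiniteType
  -- `z` is a non-regular point, hence a point at which `f` is not smooth (3.1)
  have hOsing : ∀ y ∈ Set.range (fun g : G => (ρX g).hom.base x),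
      ¬ IsRegularLocalRing (X.presheaf.stalk y) := by
    rintro _ ⟨g, rfl⟩
    exact (mem_singularLocusCodimLE_of_iso (ρX g) hx).1
  have hzreg : ¬ IsRegularLocalRing (X.presheaf.stalk z) :=
    closure_subset_not_isRegularLocalRing f q hOsing hz
  have hns : ¬ ∃ U : X.Opens, z ∈ U ∧ Smooth (U.ι ≫ f) := by
    rintro ⟨U, hzU, hU⟩
    exact hzreg (isRegularLocalRing_of_smooth_of_isRegular hreg f hU hzU)
  -- formal coordinates at `z` (2.23 + 3.3)
  obtain ⟨m, r, w, ν, eA, e, -, -, -, -, heA, he⟩ :=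
    centreFlat_exists_formalCoordinates q hreg hD f hss hqs hsm hns
  haveI : IsDomain (MvPowerSeries (Fin m) (ResidueField (Y.presheaf.stalk (f.base z)))) :=
    NoZeroDivisors.to_isDomain _
  haveI : Module.Flat (X.presheaf.stalk z) (Cpl (X.presheaf.stalk z)) :=
    AdicCompletion.flat_of_isNoetherian _
  -- `𝒪_{X,z}` is a G-ring; the rebracketed model and its variables
  have hG : IsGRing (X.presheaf.stalk z) :=
    isGRing_stalk_of_polynomial Matsumura1987_32_polynomial_holds (f ≫ q) z
  have hτ : ∀ i, (e.trans (toFormalNodeRing (ResidueField (Y.presheaf.stalk (f.base z))) m ν))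
      (algebraMap (X.presheaf.stalk z) _ ((f.stalkMap z).hom (w i))) =
        Ideal.Quotient.mk _ (MvPowerSeries.X (Sum.inr i)) := by
    intro i
    rw [RingEquiv.trans_apply, he, heA, toFormalNodeRing_mk_C_X]
  -- 3.4 ¶2 for each translate `cl{x_g}` through `z`
  have hcomp : ∀ g : G, (ρX g).hom.base x ⤳ z → ∃ i, 2 ≤ ν i ∧
      ((stalkIdeal (vanishingIdeal ⟨closure {(ρX g).hom.base x}, isClosed_closure⟩) z).map
          (algebraMap (X.presheaf.stalk z) (Cpl (X.presheaf.stalk z)))).map e.toRingHom =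
        Ideal.span {Ideal.Quotient.mk _ (MvPowerSeries.X 0), Ideal.Quotient.mk _ (MvPowerSeries.X 1),
          Ideal.Quotient.mk _ (MvPowerSeries.C (MvPowerSeries.X i))} := by
    intro g hsp
    have hxg := mem_singularLocusCodimLE_of_iso (ρX g) hx
    rw [stalkIdeal_vanishingIdeal_closure hsp]
    set P : Ideal (X.presheaf.stalk z) := primeOfSpecializes hsp with hPdef
    letI algP : Algebra (X.presheaf.stalk z) (X.presheaf.stalk ((ρX g).hom.base x)) :=
      (X.presheaf.stalkSpecializes hsp).hom.toAlgebra
    haveI hlocP : IsLocalization.AtPrime (X.presheaf.stalk ((ρX g).hom.base x)) P :=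
      isLocalizationAtPrime_stalkSpecializes hsp
    let eP : Localization.AtPrime P ≃ₐ[X.presheaf.stalk z] X.presheaf.stalk ((ρX g).hom.base x) :=
      IsLocalization.algEquiv P.primeCompl (Localization.AtPrime P) (X.presheaf.stalk ((ρX g).hom.base x))
    have hPreg : ¬ IsRegularLocalRing (Localization.AtPrime P) := fun h =>
      hxg.1 (IsRegularLocalRing.of_ringEquiv eP.toRingEquiv)
    have hPdim : ringKrullDim (Localization.AtPrime P) ≤ 2 := by
      rw [ringKrullDim_eq_of_ringEquiv eP.toRingEquiv]
      exact hxg.2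
    obtain ⟨i₀, hi₀, -, hJ⟩ :=
      codimTwo_map_adicCompletion_eq_triplePrime hG
        (e.trans (toFormalNodeRing (ResidueField (Y.presheaf.stalk (f.base z))) m ν))
        (fun i => (f.stalkMap z).hom (w i)) hτ P hPreg hPdim
    refine ⟨i₀, hi₀, ?_⟩
    have h1 : ((P.map (algebraMap (X.presheaf.stalk z) (Cpl (X.presheaf.stalk z)))).map e.toRingHom).map
        (toFormalNodeRing (ResidueField (Y.presheaf.stalk (f.base z))) m ν).toRingHom =
          triplePrime (ResidueField (Y.presheaf.stalk (f.base z))) m ν i₀ := by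
      rw [Ideal.map_map, ← hJ]
      rfl
    rw [← map_span_triple_toFormalNodeRing (ResidueField (Y.presheaf.stalk (f.base z))) m ν i₀] at h1
    have h2 := congrArg (Ideal.comap
      (toFormalNodeRing (ResidueField (Y.presheaf.stalk (f.base z))) m ν).toRingHom) h1
    rwa [Ideal.comap_map_of_bijective
        (toFormalNodeRing (ResidueField (Y.presheaf.stalk (f.base z))) m ν).toRingHom
        (toFormalNodeRing (ResidueField (Y.presheaf.stalk (f.base z))) m ν).bijective,
      Ideal.comap_map_of_bijective
        (toFormalNodeRing (ResidueField (Y.presheaf.stalk (f.base z))) m ν).toRingHom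
        (toFormalNodeRing (ResidueField (Y.presheaf.stalk (f.base z))) m ν).bijective] at h2
  choose idx hidx hJidx using hcomp
  -- the set `S` of branches through `z`
  set S : Finset (Fin m) := Finset.univ.filter
    (fun j : Fin m => ∃ (g : G) (h : (ρX g).hom.base x ⤳ z), idx g h = j) with hS
  have hS2 : ∀ j ∈ S, 2 ≤ ν j := by
    intro j hj
    obtain ⟨g, h, rfl⟩ := (Finset.mem_filter.mp hj).2
    exact hidx g h
  -- the completed ideal of `Z` is `⋂_{j ∈ S} (u, v, T_j) = (u, v, ∏_{j ∈ S} T_j)`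
  have hI : ((stalkIdeal (vanishingIdeal ⟨closure (Set.range fun g : G => (ρX g).hom.base x),
      isClosed_closure⟩) z).map (algebraMap (X.presheaf.stalk z) (Cpl (X.presheaf.stalk z)))).map
        e.toRingHom =
      Ideal.span {Ideal.Quotient.mk _ (MvPowerSeries.X 0), Ideal.Quotient.mk _ (MvPowerSeries.X 1),
        Ideal.Quotient.mk _ (MvPowerSeries.C (∏ j ∈ S, MvPowerSeries.X j))} := by
    rw [← centreFlat_iInf_span_triple_X ν S hS2]
    rw [centreFlat_stalkIdeal_vanishingIdeal_closure_orbit]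
    rw [← Finset.inf_univ_eq_iInf]
    rw [Ideal.map_finset_inf_of_flat]
    rw [Finset.inf_univ_eq_iInf]
    have hmap := centreFlat_map_iInf_ringEquiv e (fun g : G =>
      (stalkIdeal (vanishingIdeal ⟨closure {(ρX g).hom.base x}, isClosed_closure⟩) z).map
        (algebraMap (X.presheaf.stalk z) (Cpl (X.presheaf.stalk z))))
    refine hmap.trans ?_
    apply le_antisymm
    · refine le_iInf₂ fun j hj => ?_
      obtain ⟨g, h, rfl⟩ := (Finset.mem_filter.mp hj).2
      exact (iInf_le _ g).trans (hJidx g h).le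
    · refine le_iInf fun g => ?_
      by_cases h : (ρX g).hom.base x ⤳ z
      · exact (iInf₂_le (idx g h) (Finset.mem_filter.mpr ⟨Finset.mem_univ _, g, h, rfl⟩)).trans
          (hJidx g h).ge
      · rw [centreFlat_stalkIdeal_vanishingIdeal_closure_eq_top h, Ideal.map_top, Ideal.map_top]
        exact le_top
  -- `∏ Tᵢ^{νᵢ} = c t²`
  set t : MvPowerSeries (Fin m) (ResidueField (Y.presheaf.stalk (f.base z))) :=
    ∏ j ∈ S, MvPowerSeries.X j with htdef
  set c : MvPowerSeries (Fin m) (ResidueField (Y.presheaf.stalk (f.base z))) :=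
    ∏ i, MvPowerSeries.X i ^ (if i ∈ S then ν i - 2 else ν i) with hcdef
  have hct : (RingEquiv.refl (MvPowerSeries (Fin m) (ResidueField (Y.presheaf.stalk (f.base z)))))
      (∏ i, MvPowerSeries.X i ^ ν i) = c * t ^ 2 := by
    rw [RingEquiv.refl_apply, hcdef, htdef]
    exact centreFlat_prod_pow_eq_mul_sq MvPowerSeries.X ν S hS2
  have ht0 : t ≠ 0 := Finset.prod_ne_zero_iff.mpr fun j _ =>
    (MvPowerSeries.prime_X' (ResidueField (Y.presheaf.stalk (f.base z))) j).ne_zero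
  let e₁ := e.trans (DeJong1996.NodeDeformationRing.congr (RingEquiv.refl _) _ _ hct)
  let β : Y.presheaf.stalk (f.base z) →+* MvPowerSeries (Fin m) (ResidueField (Y.presheaf.stalk (f.base z))) :=
    eA.toRingHom.comp (algebraMap (Y.presheaf.stalk (f.base z)) (Cpl (Y.presheaf.stalk (f.base z))))
  refine ⟨m, c, t, ht0, e₁, β, ?_, fun a => ?_, ?_⟩
  · exact RingHom.Flat.comp (RingHom.flat_algebraMap_iff.mpr (AdicCompletion.flat_of_isNoetherian _))
      (RingHom.Flat.of_bijective eA.bijective)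
  · change DeJong1996.NodeDeformationRing.congr (RingEquiv.refl _) _ _ hct (e _) = _
    rw [he, congr_mk_C, RingEquiv.refl_apply, MvPowerSeries.c_eq_algebraMap]
    rfl
  · rw [map_nodalCentre_toNodeDeformationRing]
    change ((stalkIdeal _ z).map (algebraMap (X.presheaf.stalk z) (Cpl (X.presheaf.stalk z)))).map
      ((DeJong1996.NodeDeformationRing.congr (RingEquiv.refl _) _ _ hct).toRingHom.comp e.toRingHom) = _
    rw [← Ideal.map_map, hI, Ideal.map_span, Set.image_insert_eq, Set.image_insert_eq,
      Set.image_singleton, RingEquiv.toRingHom_eq_coe, RingHom.coe_coe, congr_mk_X, congr_mk_X,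
      congr_mk_C, RingEquiv.refl_apply]

end Summit.ResolutionOfSingularities.ResolutionOfSingularities.Theorems

end
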